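import Summits.ResolutionOfSingularities.ResolutionOfSingularities.Theorems.HilbertSamuelEliminationSigmaMaxModificationsCorridor3CPFrameHypersurfaceReading
import Summits.ResolutionOfSingularities.ResolutionOfSingularities.Theorems.HilbertSamuelEliminationSigmaMaxModificationsCorridor3HypersurfaceValues
import Literature.RingTheory.HilbertSamuel.NormalFlatnessHilbertFunction
import Literature.AlgebraicGeometry.Resolution.SymbolicPowersRegularQuotient
import Literature.AlgebraicGeometry.Resolution.ArithmeticalThreefoldsLocalProofs
import Literature.AlgebraicGeometry.Resolution.RsopMonomialIdeals
import Literature.AlgebraicGeometry.Resolution.AlterationsEnlargingZ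
import HarnessLib

/-!
# [OURS · L1 W4.2] D18 G7 — LEGALITY FROM PERMISSIBILITY in a CP frame: if the centre `V(X, u_T)` read in the frame ring `R[X]/(h)`
# is normally flat (CJS Def. 3.1 (1)), then `δ_T(h; u; X) ≥ 1`, i.e. `f_{i,X} ∈ (u_T)^i` — Bennett's equimultiplicity read on the
# hypersurface Hilbert functions
# (cell res-hironaka, LADDER-RESOLUTION rung L; slot W4.2, crux chain w42 `SigmaMaxModificationsCorridor3` stmt-ResolutionOfSingularities-19249;
# `--supports stmt-ResolutionOfSingularities-19249 --as helper`; res-L1-w42-plan-1 RULING v3.14-42 (KG)(2) «(G8) → (G7) → hread_menu»; hand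
# res-D-pv-060 (gen 8) continuing res-D-brk-3's D18 (i) chain G1–G6 (p534278 … p548461), item G7 of its gen-6 census «What is missing»)

PURE COMMUTATIVE ALGEBRA, 0 `def`s, every declaration PROVED; OURS bookkeeping; NOT a statement of Hironaka's manuscript [Hironaka2017] nor of
[CossartJannsenSaito2020]/[CossartPiltant2019]. AI-written, weaker than expert review.

WHY. The chain theorem `Moving.exists_isCPFrame_of_reaches` (…`CPFramePropagationChain`, p548461) carries ONE binder `hread`: at every reached
stage some CP frame `(R, u, h, φ)` reads the canonical centre `C` as `V(X, u_T)` — `(𝓘_{C,x_n})·B = ((u_T) + (X))/(h)`, `B = R[X]/(h)` — AND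
legally, `∀ i ∈ Icc 1 m, f_{i,X} = h.coeff (m − i) ∈ (u_T)^i` (CP's `δ_T ≥ 1`, the σ-corner model's `IsPermissible (boardOf u h) T` by res-type-064's
`isPermissible_boardOf_iff_forall_mem_pow`). This file discharges the LEGALITY half from the PERMISSIBILITY of the centre (CJS Def. 3.1 (2):
`B/P` regular and `B` normally flat along `P`), the reading being given:

* `hypersurfaceHFe_apply_one`, **`hypersurfaceHFe_injective2`** — the hypersurface Hilbert functions `hypersurfaceHFe e m` (`e, m ≥ 1`)
  determine BOTH the embedding dimension `e` and the multiplicity `m` (values at `n = 1` and `n = m`).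
* **`exists_mul_mem_pow_of_isNormallyFlat`** — `R` regular local, `h ∈ R[X]` monic of degree `m ≥ 1` with `coeff_i h ∈ 𝔪_R^{m−i}` (`δ ≥ 1`),
  `P` a prime of `B = R[X]/(h)` with `B/P` regular and `B` NORMALLY FLAT along `P`. Then `h` has ORDER `≥ m` at the preimage `Q` of `P` in `R[X]`:
  `s·h ∈ Q^m` for some `s ∉ Q`. Proof: Bennett (CJS Thm. 3.3, tree `hilbertFun_eq_hilbertSamuelFun_of_isNormallyFlat`):
  `H⁽⁰⁾(B) = (H⁽⁰⁾(B_P))^{(r)}`, `r = dim B/P`; both sides are hypersurface functions: `H⁽⁰⁾(B) = hypersurfaceHFe (dim R[X]_𝔐) m`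
  (G5 (i) `exists_frame_hypersurface_reading` + H1′) and `H⁽⁰⁾(B_P) = hypersurfaceHFe (dim R[X]_Q) μ`, `μ = ord_Q h` (Serre: `R_{Q ∩ R}` is regular,
  tree `isRegularLocalRing_localization_atPrime`; G5 (i) `exists_chart_hypersurface_reading` + H1′); `(hypersurfaceHFe (t+1) μ)^{(r)} =
  hypersurfaceHFe (t+1+r) μ` (`iterPSum_hypersurfaceHFe_succ`); joint injectivity gives `μ = ord_𝔐 h ≥ m`. NO dimension hypothesis on the centre.
* `coeff_mem_pow_of_mul_mem_pow_sup_span_X` — the powers of `Q_T = (u_T)·R[X] + (X)` are `Q_T`-primary as far as needed: `s·g ∈ Q_T^k` with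
  `s(0) ∉ (u_T)` forces `g.coeff b ∈ (u_T)^{k−b}` (induction on `b`; Matsumura 16.2 (ii) in `R`, tree
  `mem_pow_of_mul_mem_pow_of_isRegularLocalRing_quotient`, and `Polynomial.coeff_mem_pow_of_mem_sup_span_X_pow`).
* **`coeff_mem_pow_of_isNormallyFlat_of_comap_eq`** — THE G7 STATEMENT: with the reading `Q = (u_T)·R[X] + (X)` (`u` an r.s.p. of `R`,
  `T ⊆ Fin n`), normal flatness of `B` along `P` gives `∀ i ∈ Icc 1 m, h.coeff (m − i) ∈ (u_T)^i`; **`…_of_map_eq`** — the same keyed to the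
  `B`-level reading `P = Q_T·B` of `hread` plus `h.coeff 0 ∈ (u_T)` (equivalently `h ∈ Q_T`; without it the `B`-level reading does not determine
  `T`: `T = ∅`, `h = X + u₀` reads `P = (X)·B`, normally flat, yet `u₀ ∉ (u_∅)^1 = 0`).

References: CJS LNM 2270 Def. 3.1, Thm. 2.3, Thm. 3.3 [CossartJannsenSaito2020]; CP 2019 Def. 2.3, Prop. 2.5–2.7 (arXiv v1 pp. 11–14)
[CossartPiltant2019]; Matsumura Thms. 14.2, 16.2 (ii), 19.3 [Matsumura1987]; HIO Thm. (22.24) [HerrmannIkedaOrbanz1988].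
-/

noncomputable section

set_option linter.dupNamespace false

open IsLocalRing IsLocalization Polynomial
open Literature.RingTheory.HilbertSamuel Literature.AlgebraicGeometry.Resolution

universe u

namespace Summit.ResolutionOfSingularities.ResolutionOfSingularities.Theorems.SigmaMaxModificationsCorridor3.Helpers

/-! ## The hypersurface Hilbert functions determine embedding dimension and multiplicity -/

/-- `H(1)` of a hypersurface of multiplicity `m ≥ 1` in embedding dimension `e ≥ 1`: `e` if `m ≥ 2`, `e − 1` if `m = 1`.
[cite: CossartJannsenSaito2020, Thm. 2.3] -/
theorem hypersurfaceHFe_apply_one {e m : ℕ} (he : 1 ≤ e) (hm : 1 ≤ m) :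
    hypersurfaceHFe e m 1 = if m = 1 then e - 1 else e := by
  obtain ⟨t, rfl⟩ : ∃ t, e = t + 1 := ⟨e - 1, by omega⟩
  by_cases hm1 : m = 1
  · subst hm1
    rw [if_pos rfl, hypersurfaceHFe_apply, if_pos le_rfl]
    have e1 : 1 + (t + 1) - 1 = t + 1 := by omega
    have e2 : t + 1 - 1 = t := by omega
    have e3 : 1 - 1 + (t + 1) - 1 = t := by omega
    rw [e1, e2, e3, Nat.choose_succ_self_right, Nat.choose_self]
    omega
  · rw [if_neg hm1, hypersurfaceHFe_succ_apply_one (by omega)]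

/-- For `t ≥ 0` and `n ≥ 1`: `hypersurfaceHFe (t+2) 1 n = C(n+t, t)` (a hypersurface of order `1` in dimension `t + 2` is regular of dimension
`t + 1`). [cite: CossartJannsenSaito2020, Thm. 2.3] -/
theorem hypersurfaceHFe_succ_succ_one_apply {t n : ℕ} (hn : 1 ≤ n) :
    hypersurfaceHFe (t + 2) 1 n = (n + t).choose t := by
  rw [hypersurfaceHFe_apply, if_pos hn]
  have e1 : n + (t + 2) - 1 = (n + t) + 1 := by omega
  have e2 : t + 2 - 1 = t + 1 := by omega
  have e3 : n - 1 + (t + 2) - 1 = n + t := by omega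
  rw [e1, e2, e3, Nat.choose_succ_succ' (n + t) t]
  omega

/-- The value of `hypersurfaceHFe (t+1) m` AT the multiplicity `m ≥ 1`: `C(m+t, t) − 1`. [cite: CossartJannsenSaito2020, Thm. 2.3] -/
theorem hypersurfaceHFe_succ_apply_self {t m : ℕ} (hm : 1 ≤ m) :
    hypersurfaceHFe (t + 1) m m = (m + t).choose t - 1 := by
  rw [hypersurfaceHFe_apply, if_pos le_rfl]
  have e1 : m + (t + 1) - 1 = m + t := by omega
  have e2 : t + 1 - 1 = t := by omega
  have e3 : m - m + (t + 1) - 1 = t := by omega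
  rw [e1, e2, e3, Nat.choose_self]

/-- **Joint injectivity of the hypersurface Hilbert functions**: for `e, e' ≥ 1` and `m, m' ≥ 1`,
`hypersurfaceHFe e m = hypersurfaceHFe e' m'` forces `e = e'` and `m = m'` (the local ring determines its embedding dimension and its multiplicity).
[cite: CossartJannsenSaito2020, Thm. 2.3] -/
theorem hypersurfaceHFe_injective2 {e e' m m' : ℕ} (he : 1 ≤ e) (he' : 1 ≤ e') (hm : 1 ≤ m) (hm' : 1 ≤ m')
    (h : hypersurfaceHFe e m = hypersurfaceHFe e' m') : e = e' ∧ m = m' := by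
  have h1 := congr_fun h 1
  rw [hypersurfaceHFe_apply_one he hm, hypersurfaceHFe_apply_one he' hm'] at h1
  -- a hypersurface of order `1` in dimension `t + 2` is not a hypersurface of order `m' ≥ 2` in dimension `t + 1`
  have key : ∀ {t k : ℕ}, 2 ≤ k → hypersurfaceHFe (t + 2) 1 ≠ hypersurfaceHFe (t + 1) k := by
    intro t k hk heq
    have h2 := congr_fun heq k
    rw [hypersurfaceHFe_succ_succ_one_apply (by omega), hypersurfaceHFe_succ_apply_self (by omega)] at h2
    have hpos : 0 < (k + t).choose t := Nat.choose_pos (by omega)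
    omega
  by_cases hm1 : m = 1 <;> by_cases hm1' : m' = 1
  · subst hm1; subst hm1'
    rw [if_pos rfl, if_pos rfl] at h1
    exact ⟨by omega, rfl⟩
  · subst hm1
    rw [if_pos rfl, if_neg hm1'] at h1
    obtain ⟨t, rfl⟩ : ∃ t, e' = t + 1 := ⟨e' - 1, by omega⟩
    have he2 : e = t + 2 := by omega
    subst he2
    exact absurd h (key (by omega))
  · subst hm1'
    rw [if_neg hm1, if_pos rfl] at h1
    obtain ⟨t, rfl⟩ : ∃ t, e = t + 1 := ⟨e - 1, by omega⟩
    have he2 : e' = t + 2 := by omega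
    subst he2
    exact absurd h.symm (key (by omega))
  · rw [if_neg hm1, if_neg hm1'] at h1
    subst h1
    exact ⟨rfl, hypersurfaceHFe_injective he h⟩

/-! ## Bennett's equimultiplicity on a CP-frame hypersurface: normal flatness along `P` forces `ord_Q h ≥ m` -/

section Order

variable {R : Type u} [CommRing R] [IsRegularLocalRing R] {h : R[X]} [IsLocalRing (AdjoinRoot h)]

/-- [OURS · L1 W4.2] **Normal flatness ⇒ equimultiplicity, on the frame ring.** `R` regular local, `h ∈ R[X]` monic of degree `m ≥ 1` with
`coeff_i h ∈ 𝔪_R^{m−i}` (`δ ≥ 1`, so `B = R[X]/(h)` is local of multiplicity `m`), `P` a prime of `B` with `B/P` regular local along which `B` is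
NORMALLY FLAT (CJS Def. 3.1 (1), tree `Ideal.IsNormallyFlat`; with the regularity of `B/P` this is the permissibility of `V(P)` at the closed
point, Def. 3.1 (2), up to the «no component» clause). Then `h` has order `≥ m` at the preimage `Q` of `P` in `R[X]`: `s · h ∈ Q^m` for some
`s ∉ Q`. (Bennett / CJS Thm. 3.3 (1) ⇒ (2) `H⁽⁰⁾(B) = H⁽ʳ⁾(B_P)`, both sides hypersurface functions, joint injectivity.)
[cite: CossartJannsenSaito2020, Def. 3.1, Thm. 2.3, Thm. 3.3] [cite: CossartPiltant2019, Def. 2.3 and Prop. 2.5 (arXiv v1 pp. 11–13)] -/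
theorem exists_mul_mem_pow_of_isNormallyFlat (hmo : h.Monic) (hm : 0 < h.natDegree)
    (hco : ∀ i < h.natDegree, h.coeff i ∈ maximalIdeal R ^ (h.natDegree - i))
    (P : Ideal (AdjoinRoot h)) [P.IsPrime] [IsRegularLocalRing (AdjoinRoot h ⧸ P)] (hNF : P.IsNormallyFlat) :
    ∃ s ∉ P.comap (AdjoinRoot.mk h), s * h ∈ P.comap (AdjoinRoot.mk h) ^ h.natDegree := by
  -- the frame ring as a hypersurface `S₁/(h)`, `S₁ = R[X]_𝔐`
  obtain ⟨_, hreg₁, hloc₁, hne₁, hpow₁, hH₁, -⟩ := exists_frame_hypersurface_reading hmo hm hco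
  haveI := hreg₁
  haveI := hloc₁
  -- the local ring `B_P` as a hypersurface `S₂/(h)`, `S₂ = R[X]_Q`; Serre: `R_{Q ∩ R}` is regular
  haveI : IsDomain R := isDomain_of_isRegularLocalRing R
  have hreg : IsRegularLocalRing (Localization.AtPrime (((P.comap (AdjoinRoot.mk h)).comap C))) :=
    Literature.AlgebraicGeometry.Resolution.isRegularLocalRing_localization_atPrime R _
  obtain ⟨hreg₂, hloc₂, hne₂, hmax₂, hH₂, -⟩ := exists_chart_hypersurface_reading hmo P hreg
  haveI := hreg₂
  haveI := hloc₂
  -- Bennett: `H⁽⁰⁾(B) = H⁽ʳ⁾(B_P)`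
  haveI : IsNoetherianRing (AdjoinRoot h) := inferInstance
  obtain ⟨r, hr⟩ : ∃ r : ℕ, ringKrullDim (AdjoinRoot h ⧸ P) = r :=
    exists_nat_eq_of_ne_bot_of_ne_top ringKrullDim_ne_bot ringKrullDim_ne_top
  have hB : hilbertFun (AdjoinRoot h) = hilbertSamuelFun (Localization.AtPrime P) r :=
    hilbertFun_eq_hilbertSamuelFun_of_isNormallyFlat P (Localization.AtPrime P) hr hNF
  -- the orders of `h` in `S₁` and `S₂`
  set S₁ := Localization.AtPrime ((maximalIdeal (AdjoinRoot h)).comap (AdjoinRoot.mk h)) with hS₁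
  set S₂ := Localization.AtPrime (P.comap (AdjoinRoot.mk h)) with hS₂
  obtain ⟨e₁, he₁⟩ : ∃ e : ℕ, ringKrullDim S₁ = e := exists_nat_eq_of_ne_bot_of_ne_top ringKrullDim_ne_bot ringKrullDim_ne_top
  obtain ⟨e₂, he₂⟩ : ∃ e : ℕ, ringKrullDim S₂ = e := exists_nat_eq_of_ne_bot_of_ne_top ringKrullDim_ne_bot ringKrullDim_ne_top
  obtain ⟨μ₁, hμ₁, hμ₁'⟩ := exists_mem_pow_not_mem_pow_succ hne₁
  obtain ⟨μ₂, hμ₂, hμ₂'⟩ := exists_mem_pow_not_mem_pow_succ hne₂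
  have h1 := stub_H1_hilbertFun_quotient_span_singleton he₁ hμ₁ hμ₁'
  have h2 := stub_H1_hilbertFun_quotient_span_singleton he₂ hμ₂ hμ₂'
  -- `m ≤ μ₁`, `1 ≤ μ₂`
  have hmμ₁ : h.natDegree ≤ μ₁ := by
    by_contra hlt
    exact hμ₁' (Ideal.pow_le_pow_right (by omega) hpow₁)
  have hμ₂1 : 1 ≤ μ₂ := by
    by_contra hlt
    have h0 : μ₂ = 0 := by omega
    rw [h0, zero_add, pow_one] at hμ₂'
    exact hμ₂' hmax₂
  -- `1 ≤ e₁`, `1 ≤ e₂`: both local rings contain the non-zero non-unit `h`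
  have hdim1 : ∀ {S : Type u} [CommRing S] [IsRegularLocalRing S] {e : ℕ}, ringKrullDim S = e →
      ∀ {g : S}, g ≠ 0 → g ∈ maximalIdeal S → 1 ≤ e := by
    intro S _ _ e he g hg0 hg
    by_contra h0
    have hd : (maximalIdeal S).spanFinrank = 0 := by
      have h := IsRegularLocalRing.spanFinrank_maximalIdeal (R := S)
      rw [he] at h
      have h' : (maximalIdeal S).spanFinrank = e := by exact_mod_cast h
      omega
    have hbot : maximalIdeal S = ⊥ :=
      (Submodule.spanFinrank_eq_zero_iff_eq_bot (IsNoetherian.noetherian (maximalIdeal S))).mp hd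
    rw [hbot, Ideal.mem_bot] at hg
    exact hg0 hg
  have he₁1 : 1 ≤ e₁ := hdim1 he₁ hne₁ (Ideal.pow_le_self (by omega) hpow₁)
  have he₂1 : 1 ≤ e₂ := hdim1 he₂ hne₂ hmax₂
  obtain ⟨t, rfl⟩ : ∃ t, e₂ = t + 1 := ⟨e₂ - 1, by omega⟩
  -- the one functional equation
  have key : hypersurfaceHFe e₁ μ₁ = hypersurfaceHFe (t + 1 + r) μ₂ := by
    rw [← h1, ← hH₁, hB, hilbertSamuelFun, hH₂, h2, iterPSum_hypersurfaceHFe_succ]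
  obtain ⟨-, hμ⟩ := hypersurfaceHFe_injective2 he₁1 (by omega) (by omega) hμ₂1 key
  have hord : algebraMap R[X] S₂ h ∈ maximalIdeal S₂ ^ h.natDegree :=
    Ideal.pow_le_pow_right (hμ ▸ hmμ₁) hμ₂
  exact exists_mul_mem_pow_of_algebraMap_mem_pow hord

end Order

/-! ## The powers of `Q_T = (u_T)·R[X] + (X)`: coefficients of `g` from `s·g ∈ Q_T^k` -/

section Coeff

variable {R : Type u} [CommRing R]

/-- **Cancellation in the powers of `Q_T = I·R[X] + (X)`.** If `I` is an ideal of `R` whose powers are saturated with respect to every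
`a ∉ I` (`a y ∈ I^k ⇒ y ∈ I^k`) and `s · g ∈ (I·R[X] + (X))^k` with `s(0) ∉ I`, then `g.coeff b ∈ I^{k−b}` for every `b` (induction on `b`:
the coefficient of `X^b` in `s g` is `s(0) g_b` plus terms `s_i g_{b−i}`, `i ≥ 1`, already in `I^{k−b}`). [cite: Matsumura1987, Thm. 16.2 (ii)] -/
theorem coeff_mem_pow_of_mul_mem_pow_sup_span_X {I : Ideal R} (hI : ∀ (k : ℕ) {a y : R}, a ∉ I → a * y ∈ I ^ k → y ∈ I ^ k)
    {s g : R[X]} (hs : s.coeff 0 ∉ I) {k : ℕ} (hsg : s * g ∈ (I.map (C : R →+* R[X]) ⊔ Ideal.span {(X : R[X])}) ^ k) :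
    ∀ b, g.coeff b ∈ I ^ (k - b) := by
  intro b
  induction b using Nat.strong_induction_on with
  | _ b ih =>
    have hb := Literature.AlgebraicGeometry.Resolution.Polynomial.coeff_mem_pow_of_mem_sup_span_X_pow hsg b
    have hmem0 : ((0, b) : ℕ × ℕ) ∈ Finset.HasAntidiagonal.antidiagonal b :=
      Finset.HasAntidiagonal.mem_antidiagonal.mpr (zero_add b)
    rw [coeff_mul, ← Finset.add_sum_erase _ _ hmem0] at hb
    have hrest : ∑ x ∈ (Finset.HasAntidiagonal.antidiagonal b).erase (0, b), s.coeff x.1 * g.coeff x.2 ∈ I ^ (k - b) := by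
      refine Ideal.sum_mem _ fun x hx => ?_
      obtain ⟨hne, hx⟩ := Finset.mem_erase.mp hx
      rw [Finset.HasAntidiagonal.mem_antidiagonal] at hx
      have hx2 : x.2 < b := by
        rcases Nat.eq_zero_or_pos x.1 with h0 | hpos
        · exfalso; apply hne; ext <;> simp_all
        · omega
      exact Ideal.mul_mem_left _ _ (Ideal.pow_le_pow_right (by omega) (ih x.2 hx2))
    have h0b : s.coeff 0 * g.coeff b ∈ I ^ (k - b) := by
      have := sub_mem hb hrest
      rwa [add_sub_cancel_right] at this
    exact hI _ hs h0b

/-- `s ∉ I·R[X] + (X)` iff `s(0) ∉ I` (the direction used). [folklore] -/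
theorem coeff_zero_not_mem_of_not_mem_sup_span_X {I : Ideal R} {s : R[X]}
    (hs : s ∉ I.map (C : R →+* R[X]) ⊔ Ideal.span {(X : R[X])}) : s.coeff 0 ∉ I := by
  intro h0
  apply hs
  rw [← X_mul_divX_add s]
  exact Ideal.add_mem _ (Ideal.mem_sup_right (Ideal.mem_span_singleton'.mpr ⟨s.divX, mul_comm _ _⟩))
    (Ideal.mem_sup_left (Ideal.mem_map_of_mem _ h0))

end Coeff

/-! ## G7: legality of the read centre from normal flatness -/

section Legality

variable {R : Type u} [CommRing R] [IsRegularLocalRing R] {n : ℕ} {u : Fin n → R} {h : R[X]} [IsLocalRing (AdjoinRoot h)]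

/-- An r.s.p. `u` restricted to `T ⊆ Fin n` is part of a regular system of parameters; hence `(u_T)` is a prime with regular quotient.
[cite: Matsumura1987, Thm. 14.2] -/
theorem isRsopPart_comp_orderEmbOfFin (hdim : ringKrullDim R = n) (hu : Ideal.span (Set.range u) = maximalIdeal R)
    (T : Finset (Fin n)) : IsRsopPart (u ∘ fun i => T.orderEmbOfFin rfl i) := by
  classical
  refine ⟨inferInstance, Tᶜ.card, u ∘ fun i => Tᶜ.orderEmbOfFin rfl i, ?_, ?_⟩
  · rw [hdim, Finset.card_add_card_compl, Fintype.card_fin]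
  · rw [Set.range_comp, Set.range_comp, Finset.range_orderEmbOfFin, Finset.range_orderEmbOfFin, ← Set.image_union,
      ← Finset.coe_union, Finset.union_compl, Finset.coe_univ, Set.image_univ, hu]

omit [CommRing R] [IsRegularLocalRing R] in
/-- `range (u ∘ orderEmbOfFin T) = u '' T`. [folklore] -/
theorem range_comp_orderEmbOfFin (u : Fin n → R) (T : Finset (Fin n)) :
    Set.range (u ∘ fun i => T.orderEmbOfFin rfl i) = u '' ↑T := by
  rw [Set.range_comp]
  exact congrArg _ (Finset.range_orderEmbOfFin T rfl)

/-- [OURS · L1 W4.2] **D18 G7: legality from normal flatness, polynomial-level reading.** `R` regular local of dimension `n` with r.s.p. `u`,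
`h ∈ R[X]` monic of degree `m ≥ 1` with `δ ≥ 1`, `P` a prime of `B = R[X]/(h)` with `B/P` regular and `B` normally flat along `P`, whose
preimage in `R[X]` is `Q_T = (u_T)·R[X] + (X)`. Then `δ_T ≥ 1`: `h.coeff (m − i) ∈ (u_T)^i` for `1 ≤ i ≤ m` — the legality clause of `hread`
(`…CPFramePropagationChain`). [cite: CossartJannsenSaito2020, Def. 3.1, Thm. 3.3] [cite: CossartPiltant2019, Def. 2.3, Prop. 2.5–2.7 (arXiv v1 pp. 11–14)] -/
theorem coeff_mem_pow_of_isNormallyFlat_of_comap_eq (hdim : ringKrullDim R = n) (hu : Ideal.span (Set.range u) = maximalIdeal R)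
    (hmo : h.Monic) (hm : 0 < h.natDegree) (hco : ∀ i < h.natDegree, h.coeff i ∈ maximalIdeal R ^ (h.natDegree - i))
    (P : Ideal (AdjoinRoot h)) [P.IsPrime] [IsRegularLocalRing (AdjoinRoot h ⧸ P)] (hNF : P.IsNormallyFlat) (T : Finset (Fin n))
    (hQ : P.comap (AdjoinRoot.mk h) = (Ideal.span (u '' ↑T)).map (C : R →+* R[X]) ⊔ Ideal.span {(X : R[X])}) :
    ∀ i ∈ Finset.Icc 1 h.natDegree, h.coeff (h.natDegree - i) ∈ Ideal.span (u '' ↑T) ^ i := by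
  obtain ⟨s, hs, hsh⟩ := exists_mul_mem_pow_of_isNormallyFlat hmo hm hco P hNF
  rw [hQ] at hs hsh
  -- `(u_T)` is a prime with regular quotient: its powers are saturated
  have hz := isRsopPart_comp_orderEmbOfFin hdim hu T
  have hrange := range_comp_orderEmbOfFin u T
  haveI : (Ideal.span (u '' ↑T)).IsPrime := by rw [← hrange]; exact hz.isPrime_span_range
  haveI : IsRegularLocalRing (R ⧸ Ideal.span (u '' ↑T)) := by rw [← hrange]; exact hz.isRegularLocalRing_quotient
  have hI : ∀ (k : ℕ) {a y : R}, a ∉ Ideal.span (u '' ↑T) → a * y ∈ Ideal.span (u '' ↑T) ^ k → y ∈ Ideal.span (u '' ↑T) ^ k :=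
    fun k a y ha hay => mem_pow_of_mul_mem_pow_of_isRegularLocalRing_quotient ha k hay
  have hcoeff := coeff_mem_pow_of_mul_mem_pow_sup_span_X hI (coeff_zero_not_mem_of_not_mem_sup_span_X hs) hsh
  intro i hi
  have h1 := hcoeff (h.natDegree - i)
  rwa [show h.natDegree - (h.natDegree - i) = i by have := (Finset.mem_Icc.mp hi).2; omega] at h1

/-- [OURS · L1 W4.2] **D18 G7, keyed to the `B`-level reading of `hread`.** As `coeff_mem_pow_of_isNormallyFlat_of_comap_eq`, with the centre
given as the ideal `P_T = ((u_T)·R[X] + (X))·B` of `B = R[X]/(h)` (the shape of `hread`'s reading clause) together with `h.coeff 0 ∈ (u_T)`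
(i.e. `h ∈ Q_T`, so that `Q_T` IS the preimage of `P_T`; necessary — see the module docstring). [cite: CossartJannsenSaito2020, Def. 3.1, Thm. 3.3]
[cite: CossartPiltant2019, Def. 2.3, Prop. 2.5–2.7 (arXiv v1 pp. 11–14)] -/
theorem coeff_mem_pow_of_isNormallyFlat_of_map_eq (hdim : ringKrullDim R = n) (hu : Ideal.span (Set.range u) = maximalIdeal R)
    (hmo : h.Monic) (hm : 0 < h.natDegree) (hco : ∀ i < h.natDegree, h.coeff i ∈ maximalIdeal R ^ (h.natDegree - i))
    (T : Finset (Fin n)) (h0 : h.coeff 0 ∈ Ideal.span (u '' ↑T))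
    (P : Ideal (AdjoinRoot h)) [P.IsPrime] [IsRegularLocalRing (AdjoinRoot h ⧸ P)] (hNF : P.IsNormallyFlat)
    (hP : P = ((Ideal.span (u '' ↑T)).map (C : R →+* R[X]) ⊔ Ideal.span {(X : R[X])}).map (AdjoinRoot.mk h)) :
    ∀ i ∈ Finset.Icc 1 h.natDegree, h.coeff (h.natDegree - i) ∈ Ideal.span (u '' ↑T) ^ i := by
  refine coeff_mem_pow_of_isNormallyFlat_of_comap_eq hdim hu hmo hm hco P hNF T ?_
  -- `Q_T ⊔ ker mk = Q_T` since `h ∈ Q_T`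
  have hmem : h ∈ (Ideal.span (u '' ↑T)).map (C : R →+* R[X]) ⊔ Ideal.span {(X : R[X])} := by
    rw [← X_mul_divX_add h]
    exact Ideal.add_mem _ (Ideal.mem_sup_right (Ideal.mem_span_singleton'.mpr ⟨h.divX, mul_comm _ _⟩))
      (Ideal.mem_sup_left (Ideal.mem_map_of_mem _ h0))
  have hker : RingHom.ker (AdjoinRoot.mk h) = Ideal.span {h} := Ideal.mk_ker
  rw [hP, Ideal.comap_map_of_surjective _ AdjoinRoot.mk_surjective, sup_eq_left,
    show Ideal.comap (AdjoinRoot.mk h) ⊥ = RingHom.ker (AdjoinRoot.mk h) from rfl, hker, Ideal.span_singleton_le_iff_mem]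
  exact hmem

end Legality

end Summit.ResolutionOfSingularities.ResolutionOfSingularities.Theorems.SigmaMaxModificationsCorridor3.Helpers

end
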